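import Mathlib
import Summits.CriticalPhenomena.PercolationContinuityZ3.Theorems.PercNearOneGluingNoHeavyLowerTailOrientedAntipodalHallStrictCyclic

/-!
# The strict-cyclic-surplus hypothesis fails: a tight Hall family with a cyclic triple on six points

Helper file for crux `stmt-CriticalPhenomena-4575` (`NoHeavyLowerTail`, route `PercNearOneGluingNoHeavy`), hull-port seat `prim-hp-7`
(generation 58); `--supports stmt-CriticalPhenomena-4575`.  Everything here is PROVED; no definitions (the witnesses live inside the proofs).

`card_le_card_goods_above_of_strictCyclic` (gen 56) reduces CoI-Kleitman on three petals to the hypothesis `hstrict` (STRICT CYCLIC SURPLUS):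
every co-intersecting family of antipodal bads that contains a cyclic triple of types and satisfies Hall's counting condition on all its
sub-families has strictly more goods above it than members.  This file shows that `hstrict` is NOT a theorem: on the ground set `Fin 6`
with the monotone labelling generated by the seeds `C₀ : 034 234 035 235 045 245 345`, `C₁ : 02 013 123`, `C₂ : 14 15`
(`f U = A` iff `U` contains seeds of two petals, `C_p` iff only of petal `p`, `B` iff none), the ten 3-sets containing the point `3` are
antipodal bads of the five ordered types `(0,1),(1,0),(0,2),(1,2),(2,1)` — containing the cyclic triple `(0,2),(2,1),(1,0)` —, they are
pairwise co-intersecting, they have distinct good representatives (so Hall's condition holds for every sub-family), and EXACTLY ten goods lie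
above them (`exists_tight_hall_family_with_cyclic_triple`).  Hence the strictness hypothesis fails for this labelling
(`not_strictCyclicSurplus_hypothesis`): the gen-56 route 'strict cyclic surplus ⟹ T6' cannot be completed, although CoI-Kleitman itself is
not violated here.  Found by simulated annealing in the middle layer of `2^[6]` with free types (memo
`prim-hp-7/FROM-prim-hp-7-g58-SCS-REFUTED.md`); de-starred it is Katona's extremal intersecting family `([5] choose 3)`.
(prim-hp-7 gen 58, 2026-08-22.)
-/

namespace Summit.CriticalPhenomena.PercolationContinuityZ3.Theorems

namespace OrientedAntipodalHall

open Finset AntipodalStrongHarris AntipodalStrongHarris.Lab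

/-- The label attached to a membership pattern `(b₀, b₁, b₂)` ('`X` contains a seed of petal `p`'): `A` if two petals, `C_p` if exactly
petal `p`, `B` if none.  Monotone in each Boolean coordinate for the order `B < C_p < A` (64 cases). -/
theorem seedPattern_mono :
    ∀ b₀ b₁ b₂ c₀ c₁ c₂ : Bool, (b₀ = true → c₀ = true) → (b₁ = true → c₁ = true) → (b₂ = true → c₂ = true) →
      (let g : Bool → Bool → Bool → Lab 3 := fun x y z =>
        if (x && y) || (x && z) || (y && z) then top else if x then petal 0 else if y then petal 1 else if z then petal 2 else bot
       g b₀ b₁ b₂ = bot ∨ g c₀ c₁ c₂ = top ∨ g b₀ b₁ b₂ = g c₀ c₁ c₂) := by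
  decide

/-- **A tight Hall family with a cyclic triple (six points, three petals).**  There are a monotone labelling `f` of the subsets of
`Fin 6`, type maps `i, j` and a family `D` of ten antipodal bads of `S = univ` with types among the petals `0, 1, 2`, pairwise
co-intersecting, containing bads of the cyclic triple of types `(0,2), (2,1), (1,0)`, satisfying Hall's counting condition on every
sub-family, and with exactly `#D = 10` goods above its members. -/
theorem exists_tight_hall_family_with_cyclic_triple :
    ∃ (f : Finset (Fin 6) → Lab 3) (i j : Finset (Fin 6) → Fin 3) (D : Finset (Finset (Fin 6))),
      (∀ ⦃X Y : Finset (Fin 6)⦄, X ⊆ Y → f X ≤ f Y) ∧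
      (∀ X ∈ D, X ⊆ (univ : Finset (Fin 6))) ∧ (∀ X ∈ D, f X = petal (i X)) ∧
      (∀ X ∈ D, f (univ \ X) = petal (j X)) ∧
      (∀ X ∈ D, (i X = 0 ∨ i X = 1 ∨ i X = 2) ∧ (j X = 0 ∨ j X = 1 ∨ j X = 2)) ∧
      (∀ X ∈ D, ∀ Y ∈ D, X ∪ Y ≠ univ) ∧
      (∃ u v w : Fin 3, (∃ X ∈ D, i X = u ∧ j X = v) ∧ (∃ Y ∈ D, i Y = v ∧ j Y = w) ∧ (∃ Z ∈ D, i Z = w ∧ j Z = u)) ∧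
      (∀ D'' ⊆ D, #D'' ≤ #{U ∈ (univ : Finset (Fin 6)).powerset | f U = top ∧ f (univ \ U) = bot ∧ ∃ X ∈ D'', X ⊆ U}) ∧
      #{U ∈ (univ : Finset (Fin 6)).powerset | f U = top ∧ f (univ \ U) = bot ∧ ∃ X ∈ D, X ⊆ U} = #D ∧ #D = 10 := by
  classical
  -- the seeds
  let S₀ : List (Finset (Fin 6)) := [{0,3,4}, {2,3,4}, {0,3,5}, {2,3,5}, {0,4,5}, {2,4,5}, {3,4,5}]
  let S₁ : List (Finset (Fin 6)) := [{0,2}, {0,1,3}, {1,2,3}]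
  let S₂ : List (Finset (Fin 6)) := [{1,4}, {1,5}]
  let g : Bool → Bool → Bool → Lab 3 := fun x y z =>
    if (x && y) || (x && z) || (y && z) then top else if x then petal 0 else if y then petal 1 else if z then petal 2 else bot
  let f : Finset (Fin 6) → Lab 3 := fun X => g (S₀.any (· ⊆ X)) (S₁.any (· ⊆ X)) (S₂.any (· ⊆ X))
  -- type maps read off the labels
  let i : Finset (Fin 6) → Fin 3 := fun X => match f X with | petal c => c | _ => 0
  let j : Finset (Fin 6) → Fin 3 := fun X => match f (univ \ X) with | petal c => c | _ => 0
  let D : Finset (Finset (Fin 6)) :=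
    {{3,4,5}, {0,1,3}, {2,3,5}, {2,3,4}, {0,2,3}, {1,3,5}, {1,3,4}, {0,3,4}, {0,3,5}, {1,2,3}}
  refine ⟨f, i, j, D, ?_, ?_, ?_, ?_, ?_, ?_, ?_, ?_, ?_, ?_⟩
  · -- monotone
    intro X Y hXY
    have key := seedPattern_mono (S₀.any (· ⊆ X)) (S₁.any (· ⊆ X)) (S₂.any (· ⊆ X))
      (S₀.any (· ⊆ Y)) (S₁.any (· ⊆ Y)) (S₂.any (· ⊆ Y))
      (fun h => by rw [List.any_eq_true] at h ⊢; obtain ⟨s, hs, hsub⟩ := h; exact ⟨s, hs, by simpa using (show s ⊆ Y from (by simpa using hsub : s ⊆ X).trans hXY)⟩)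
      (fun h => by rw [List.any_eq_true] at h ⊢; obtain ⟨s, hs, hsub⟩ := h; exact ⟨s, hs, by simpa using (show s ⊆ Y from (by simpa using hsub : s ⊆ X).trans hXY)⟩)
      (fun h => by rw [List.any_eq_true] at h ⊢; obtain ⟨s, hs, hsub⟩ := h; exact ⟨s, hs, by simpa using (show s ⊆ Y from (by simpa using hsub : s ⊆ X).trans hXY)⟩)
    exact key
  · intro X _; exact subset_univ X
  · -- f X = petal (i X) on members
    intro X hX
    simp only [D, mem_insert, mem_singleton] at hX
    rcases hX with rfl | rfl | rfl | rfl | rfl | rfl | rfl | rfl | rfl | rfl <;> decide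
  · intro X hX
    simp only [D, mem_insert, mem_singleton] at hX
    rcases hX with rfl | rfl | rfl | rfl | rfl | rfl | rfl | rfl | rfl | rfl <;> decide
  · intro X _
    constructor <;> omega
  · -- co-intersecting
    intro X hX Y hY
    simp only [D, mem_insert, mem_singleton] at hX hY
    rcases hX with rfl | rfl | rfl | rfl | rfl | rfl | rfl | rfl | rfl | rfl <;>
      rcases hY with rfl | rfl | rfl | rfl | rfl | rfl | rfl | rfl | rfl | rfl <;> decide
  · -- cyclic triple (0,2),(2,1),(1,0): {2,3,5}, {1,3,5}, {0,1,3}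
    refine ⟨0, 2, 1, ⟨{2,3,5}, by decide, by decide, by decide⟩, ⟨{1,3,5}, by decide, by decide, by decide⟩,
      ⟨{0,1,3}, by decide, by decide, by decide⟩⟩
  · -- Hall for every sub-family, from an explicit system of distinct good representatives
    intro D'' hD''
    let φ : Finset (Fin 6) → Finset (Fin 6) := fun X =>
      if X = {3,4,5} then {0,1,3,4,5} else if X = {0,1,3} then {0,1,3,5} else if X = {2,3,5} then univ
      else if X = {2,3,4} then {0,1,2,3,4} else if X = {0,2,3} then {0,2,3,4,5} else if X = {1,3,5} then {1,2,3,5}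
      else if X = {1,3,4} then {1,2,3,4,5} else if X = {0,3,4} then {0,1,3,4} else if X = {0,3,5} then {0,1,2,3,5}
      else {1,2,3,4}
    have hinj : Set.InjOn φ (D : Set (Finset (Fin 6))) := by
      intro X hX Y hY hXY
      simp only [D, coe_insert, coe_singleton, Set.mem_insert_iff, Set.mem_singleton_iff] at hX hY
      rcases hX with rfl | rfl | rfl | rfl | rfl | rfl | rfl | rfl | rfl | rfl <;>
        rcases hY with rfl | rfl | rfl | rfl | rfl | rfl | rfl | rfl | rfl | rfl <;> revert hXY <;> decide
    have hgood : ∀ X ∈ D, φ X ∈ (univ : Finset (Fin 6)).powerset ∧ f (φ X) = top ∧ f (univ \ φ X) = bot ∧ X ⊆ φ X := by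
      decide
    calc #D'' = #(D''.image φ) := (card_image_of_injOn (fun X hX Y hY h => hinj (hD'' hX) (hD'' hY) h)).symm
      _ ≤ _ := by
        refine card_le_card ?_
        intro U hU
        obtain ⟨X, hX, rfl⟩ := mem_image.mp hU
        obtain ⟨h1, h2, h3, h4⟩ := hgood X (hD'' hX)
        exact mem_filter.mpr ⟨h1, h2, h3, X, hX, h4⟩
  · -- exactly ten goods above the family
    have hsub : {U ∈ (univ : Finset (Fin 6)).powerset | f U = top ∧ f (univ \ U) = bot ∧ ∃ X ∈ D, X ⊆ U} =
        ({{0,1,3,4}, {1,2,3,4}, {0,1,2,3,4}, {0,1,3,5}, {1,2,3,5}, {0,1,2,3,5}, {0,1,3,4,5}, {0,2,3,4,5}, {1,2,3,4,5}, univ} :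
          Finset (Finset (Fin 6))) := by
      decide
    rw [hsub]
    decide
  · decide

/-- **The strict-cyclic-surplus hypothesis is not a theorem.**  For `S = univ ⊆ Fin 6`, the petals `0, 1, 2` and the labelling and type
maps of `exists_tight_hall_family_with_cyclic_triple`, the hypothesis `hstrict` of `card_le_card_goods_above_of_strictCyclic` fails. -/
theorem not_strictCyclicSurplus_hypothesis :
    ∃ (f : Finset (Fin 6) → Lab 3) (i j : Finset (Fin 6) → Fin 3),
      (∀ ⦃X Y : Finset (Fin 6)⦄, X ⊆ Y → f X ≤ f Y) ∧
      ¬ (∀ D' : Finset (Finset (Fin 6)), (∀ X ∈ D', X ⊆ (univ : Finset (Fin 6))) → (∀ X ∈ D', f X = petal (i X)) →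
        (∀ X ∈ D', f (univ \ X) = petal (j X)) →
        (∀ X ∈ D', (i X = (0 : Fin 3) ∨ i X = 1 ∨ i X = 2) ∧ (j X = (0 : Fin 3) ∨ j X = 1 ∨ j X = 2)) →
        (∀ X ∈ D', ∀ Y ∈ D', X ∪ Y ≠ univ) →
        (∃ u v w : Fin 3, (∃ X ∈ D', i X = u ∧ j X = v) ∧ (∃ Y ∈ D', i Y = v ∧ j Y = w) ∧ (∃ Z ∈ D', i Z = w ∧ j Z = u)) →
        (∀ D'' ⊆ D', #D'' ≤ #{U ∈ (univ : Finset (Fin 6)).powerset | f U = top ∧ f (univ \ U) = bot ∧ ∃ X ∈ D'', X ⊆ U}) →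
        #D' + 1 ≤ #{U ∈ (univ : Finset (Fin 6)).powerset | f U = top ∧ f (univ \ U) = bot ∧ ∃ X ∈ D', X ⊆ U}) := by
  obtain ⟨f, i, j, D, hf, hDS, hDi, hDj, hP, hco, hcyc, hHall, hcount, hcard⟩ :=
    exists_tight_hall_family_with_cyclic_triple
  refine ⟨f, i, j, hf, fun h => ?_⟩
  have := h D hDS hDi hDj hP hco hcyc hHall
  omega

end OrientedAntipodalHall

end Summit.CriticalPhenomena.PercolationContinuityZ3.Theorems
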